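import Literature.Analysis.FluidPDE.TaoCascadeMotion
import Literature.Analysis.FluidPDE.TaoAveragedConjugation
import Literature.Analysis.FluidPDE.TaoAveragedComplexAverage
import HarnessLib

/-!
# Tao's averaged Navier–Stokes blow-up: the Fourier projections `u_{i,n}` of Lemma 4.1

T. Tao, *Finite time blowup for an averaged three-dimensional Navier–Stokes equation*,
J. Amer. Math. Soc. **29** (2016), 601–674 = arXiv:1402.0290v3 (held as `paper:arxiv-1402.0290`),
§4, proof of Lemma 4.1, p. 22: "Taking Fourier transforms … we thus have a decomposition
`u(t) = ∑ₙ ∑ᵢ u_{i,n}(t)` … Taking inner products of (4.14) with `ψ_{i,n}` …". Infrastructure,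
over the accepted objects of `TaoCascadeMotion.lean` (`freqRegion`, `modeProjection`,
`modeCoeff`, `modeEnergy`, `equationsOfMotion`) and `TaoAveragedConjugation.lean` (`conjL2`,
`fourierFn_conjL2`), for the proof of Lemma 4.1 (`equationsOfMotion`). Everything is **proved**:

* `eq_of_fourierFn_ae_eq` — `L²` fields are determined by their Fourier transforms;
* `fourierFn_modeProjection` (`\widehat{u_{i,n}} = 1_{A_{i,n}} û`) and its consequences:
  `P_{i,n}` is idempotent, linear, commutes with `e^{τΔ}` (`modeProjection_heat`), is an
  `H^s`-contraction (`eFourierSobolevNorm_modeProjection_le`, `norm_modeProjection_le`), preserves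
  divergence-freeness and — its symbol being real and even — realness (`conjL2_modeProjection`),
  hence **maps `H¹⁰_df` to itself** (`MemH10df.modeProjection`);
* `pairing_eq_integral_cdot_fourierFn` — Parseval for the bilinear pairing,
  `⟨u, w⟩ = ∫ û(ξ)·ŵ(-ξ) dξ`; `pairing_modeProjection_left` — `⟨P u, w⟩ = ⟨u, P w⟩`;
  `norm_sq_eq_integral_fourierFn`, `norm_sq_modeProjection` — `‖u_{i,n}‖² = ∫_{A_{i,n}} |û|²`;
* `pairing_heat_left`, `conjL2_heat`, `IsReal.heat`, `MemH10df.heat` — the heat flow is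
  self-adjoint for the pairing and maps `H¹⁰_df` to itself (including the realness clause left
  open in `TaoAveragedSobolev.lean`);
* `quadTermC`, `cascadeOperatorForm_eq_quadTermC_mul` — **the cascade operator (4.1) tested
  against a field paired only with `ψ_{i,n}` collapses to `quadTerm_{i,n} · ⟨g, ψ_{i,n}⟩`** (each
  scale series has at most one nonzero term), and `quadTermC_eq_ofReal` (on real fields it is the
  accepted real `TaoCascade.quadTerm` of the coefficients `Re⟨f, ψ_{j,k}⟩`);
* `MemH10df.add/smul/sub`, `eq_zero_of_pairing_self_eq_zero` — `H¹⁰_df` is a real subspace and a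
  real field with `⟨w, w⟩ = 0` vanishes (how identities in `(H¹⁰_df)*` become identities in `L²`).

## References

* T. Tao, J. Amer. Math. Soc. 29 (2016), 601–674, arXiv:1402.0290v3, §4 Lemma 4.1, p. 22,
  (1.15), (4.10), (4.14)–(4.15). Key `Tao2016AveragedNS`.
-/

noncomputable section

open MeasureTheory Set Filter FourierTransform Metric
open scoped ENNReal NNReal SchwartzMap Topology ComplexConjugate

namespace Literature.Analysis.FluidPDE.Tao2016

variable {ε₀ : ℝ} {m : ℕ}

/-! ### `L²` fields are determined by their Fourier transforms -/

/-- Two `L²` fields with a.e. equal Fourier transforms are equal (Plancherel: `𝓕` is an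
isometry of `L²`). [folklore] -/
theorem eq_of_fourierFn_ae_eq {u v : L2C} (h : fourierFn u =ᵐ[volume] fourierFn v) : u = v :=
  (MeasureTheory.Lp.fourierTransformₗᵢ (EuclideanSpace ℝ (Fin 3)) (EuclideanSpace ℂ (Fin 3))).injective
    (Lp.ext h)

/-! ### The frequency regions -/

/-- The frequency region of the mode `(i,n)` is symmetric under `ξ ↦ -ξ` (it is
`(1+ε₀)ⁿ · (Bᵢ ∪ -Bᵢ)`). [cite: Tao2016AveragedNS, Lemma 4.1] -/
theorem neg_mem_freqRegion_iff (𝒟 : CascadeWaveletData ε₀ m) (i : Fin m) (n : ℤ) (ξ : EuclideanSpace ℝ (Fin 3)) :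
    -ξ ∈ freqRegion 𝒟 i n ↔ ξ ∈ freqRegion 𝒟 i n := by
  simp only [freqRegion, mem_preimage, smul_neg, mem_union, Set.mem_neg, neg_neg]
  exact Or.comm

/-- The indicator symbol of the region is even. [folklore] -/
theorem indicator_freqRegion_neg (𝒟 : CascadeWaveletData ε₀ m) (i : Fin m) (n : ℤ)
    (ξ : EuclideanSpace ℝ (Fin 3)) :
    (freqRegion 𝒟 i n).indicator (fun _ => (1 : ℂ)) (-ξ) =
      (freqRegion 𝒟 i n).indicator (fun _ => (1 : ℂ)) ξ := by
  by_cases h : ξ ∈ freqRegion 𝒟 i n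
  · rw [indicator_of_mem h, indicator_of_mem ((neg_mem_freqRegion_iff 𝒟 i n ξ).2 h)]
  · rw [indicator_of_notMem h, indicator_of_notMem (fun h' => h ((neg_mem_freqRegion_iff 𝒟 i n ξ).1 h'))]

/-! ### The projection on the Fourier side -/

section Projection

variable (𝒟 : CascadeWaveletData ε₀ m) (i : Fin m) (n : ℤ)

/-- **The Fourier transform of the projection**: `\widehat{u_{i,n}} = 1_{A_{i,n}} û` a.e.
(Tao 2016, Lemma 4.1, the defining display of `u_{i,n}`). [cite: Tao2016AveragedNS, Lemma 4.1] -/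
theorem fourierFn_modeProjection (u : L2C) :
    fourierFn (modeProjection 𝒟 i n u) =ᵐ[volume] fun ξ =>
      (freqRegion 𝒟 i n).indicator (fun _ => (1 : ℂ)) ξ • fourierFn u ξ := by
  unfold modeProjection
  filter_upwards [fourierFn_fourierMultiplier
      ((memLp_top_indicator_one (measurableSet_freqRegion 𝒟 i n)).toLp _) u,
    MemLp.coeFn_toLp (memLp_top_indicator_one (measurableSet_freqRegion 𝒟 i n))] with ξ h1 h2
  rw [h1, h2]

/-- The projection is idempotent: `P_{i,n} P_{i,n} = P_{i,n}`. [folklore] -/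
theorem modeProjection_modeProjection (u : L2C) :
    modeProjection 𝒟 i n (modeProjection 𝒟 i n u) = modeProjection 𝒟 i n u := by
  apply eq_of_fourierFn_ae_eq
  filter_upwards [fourierFn_modeProjection 𝒟 i n (modeProjection 𝒟 i n u),
    fourierFn_modeProjection 𝒟 i n u] with ξ h1 h2
  rw [h1, h2, smul_smul]
  by_cases h : ξ ∈ freqRegion 𝒟 i n
  · simp [indicator_of_mem h]
  · simp [indicator_of_notMem h]

/-- The projection is additive. [folklore] -/
theorem modeProjection_add (u v : L2C) :
    modeProjection 𝒟 i n (u + v) = modeProjection 𝒟 i n u + modeProjection 𝒟 i n v := by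
  apply eq_of_fourierFn_ae_eq
  filter_upwards [fourierFn_modeProjection 𝒟 i n (u + v), fourierFn_add u v,
    fourierFn_add (modeProjection 𝒟 i n u) (modeProjection 𝒟 i n v),
    fourierFn_modeProjection 𝒟 i n u, fourierFn_modeProjection 𝒟 i n v] with ξ h1 h2 h3 h4 h5
  rw [h1, h2, h3, h4, h5, smul_add]

/-- The projection is homogeneous. [folklore] -/
theorem modeProjection_smul (c : ℂ) (u : L2C) :
    modeProjection 𝒟 i n (c • u) = c • modeProjection 𝒟 i n u := by
  apply eq_of_fourierFn_ae_eq
  filter_upwards [fourierFn_modeProjection 𝒟 i n (c • u), fourierFn_smul c u,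
    fourierFn_smul c (modeProjection 𝒟 i n u), fourierFn_modeProjection 𝒟 i n u]
    with ξ h1 h2 h3 h4
  rw [h1, h2, h3, h4, smul_comm]

/-- The projection of the zero field is zero. [folklore] -/
theorem modeProjection_zero : modeProjection 𝒟 i n 0 = 0 := by
  simpa using modeProjection_smul 𝒟 i n 0 0

/-- The projection is subtractive. [folklore] -/
theorem modeProjection_sub (u v : L2C) :
    modeProjection 𝒟 i n (u - v) = modeProjection 𝒟 i n u - modeProjection 𝒟 i n v := by
  rw [sub_eq_add_neg, modeProjection_add, ← neg_one_smul ℂ v, modeProjection_smul, neg_one_smul,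
    sub_eq_add_neg]

/-- **The projection commutes with the heat flow** (both are Fourier multipliers). [folklore] -/
theorem modeProjection_heat (τ : ℝ) (u : L2C) :
    modeProjection 𝒟 i n (heat τ u) = heat τ (modeProjection 𝒟 i n u) := by
  apply eq_of_fourierFn_ae_eq
  filter_upwards [fourierFn_modeProjection 𝒟 i n (heat τ u), fourierFn_heat τ u,
    fourierFn_heat τ (modeProjection 𝒟 i n u), fourierFn_modeProjection 𝒟 i n u]
    with ξ h1 h2 h3 h4
  rw [h1, h2, h3, h4, smul_comm]

/-- **The projection is an `H^s`-contraction** for every Sobolev exponent (in particular it maps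
`H¹⁰` to `H¹⁰`, and for `s = 0` it is an `L²` contraction). [folklore] -/
theorem eFourierSobolevNorm_modeProjection_le (s : ℝ) (u : L2C) :
    FunctionSpaces.eFourierSobolevNorm s (modeProjection 𝒟 i n u) ≤
      FunctionSpaces.eFourierSobolevNorm s u := by
  unfold FunctionSpaces.eFourierSobolevNorm
  refine ENNReal.rpow_le_rpow ?_ (by norm_num)
  refine lintegral_mono_ae ?_
  filter_upwards [fourierFn_modeProjection 𝒟 i n u] with ξ hξ
  change _ * ‖fourierFn (modeProjection 𝒟 i n u) ξ‖ₑ ^ 2 ≤ _ * ‖fourierFn u ξ‖ₑ ^ 2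
  rw [hξ, enorm_smul]
  gcongr
  refine mul_le_of_le_one_left zero_le ?_
  by_cases h : ξ ∈ freqRegion 𝒟 i n
  · simp [indicator_of_mem h]
  · simp [indicator_of_notMem h]

/-- The projection is an `L²` contraction: `‖u_{i,n}‖ ≤ ‖u‖`. [folklore] -/
theorem norm_modeProjection_le (u : L2C) : ‖modeProjection 𝒟 i n u‖ ≤ ‖u‖ := by
  have h := eFourierSobolevNorm_modeProjection_le 𝒟 i n 0 u
  rw [FunctionSpaces.eFourierSobolevNorm_zero_eq_enorm,
    FunctionSpaces.eFourierSobolevNorm_zero_eq_enorm] at h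
  rwa [← ofReal_norm, ← ofReal_norm, ENNReal.ofReal_le_ofReal_iff (norm_nonneg _)] at h

/-- **The projection preserves divergence-freeness** (a scalar symbol commutes with `ξ ·`). [folklore] -/
theorem IsFourierDivFree.modeProjection {u : L2C} (hu : IsFourierDivFree u) :
    IsFourierDivFree (modeProjection 𝒟 i n u) := by
  unfold IsFourierDivFree at *
  filter_upwards [hu, fourierFn_modeProjection 𝒟 i n u] with ξ h1 h2
  rw [h2, cdot_smul_right, h1, mul_zero]

/-- A field is real iff it equals its conjugate. [folklore] -/
theorem isReal_iff_conjL2_eq (u : L2C) : IsReal u ↔ conjL2 u = u := by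
  constructor
  · intro hu
    apply Lp.ext
    filter_upwards [coeFn_conjL2 u, hu] with x h1 h2
    rw [h1]
    ext k
    rw [conj3_apply, Complex.conj_eq_iff_im]
    exact h2 k
  · intro hu
    unfold IsReal
    filter_upwards [coeFn_conjL2 u, Lp.ext_iff.1 hu] with x h1 h2
    intro k
    rw [← Complex.conj_eq_iff_im]
    have := congrArg (fun z : EuclideanSpace ℂ (Fin 3) => z k) (h1.symm.trans h2)
    simpa using this

/-- **The projection preserves realness**: its symbol `1_{A_{i,n}}` is real and even, so
`\overline{P u} = P ū` (`𝓕(ū)(ξ) = \overline{𝓕u(-ξ)}`). [folklore] -/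
theorem conjL2_modeProjection (u : L2C) :
    conjL2 (modeProjection 𝒟 i n u) = modeProjection 𝒟 i n (conjL2 u) := by
  apply eq_of_fourierFn_ae_eq
  have hq : Measure.QuasiMeasurePreserving (fun x : EuclideanSpace ℝ (Fin 3) => -x) volume volume :=
    (Measure.measurePreserving_neg (volume : Measure (EuclideanSpace ℝ (Fin 3)))).quasiMeasurePreserving
  filter_upwards [fourierFn_conjL2 (modeProjection 𝒟 i n u),
    hq.ae_eq (fourierFn_modeProjection 𝒟 i n u), fourierFn_modeProjection 𝒟 i n (conjL2 u),
    fourierFn_conjL2 u] with ξ h1 h2 h3 h4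
  rw [h1, h3, h4]
  rw [show fourierFn (modeProjection 𝒟 i n u) (-ξ) =
      (freqRegion 𝒟 i n).indicator (fun _ => (1 : ℂ)) (-ξ) • fourierFn u (-ξ) from h2, conj3_smul,
    indicator_freqRegion_neg]
  congr 1
  by_cases h : ξ ∈ freqRegion 𝒟 i n
  · simp [indicator_of_mem h]
  · simp [indicator_of_notMem h]

/-- The projection of a real field is real. [folklore] -/
theorem IsReal.modeProjection {u : L2C} (hu : IsReal u) : IsReal (modeProjection 𝒟 i n u) := by
  rw [isReal_iff_conjL2_eq] at hu ⊢
  rw [conjL2_modeProjection, hu]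

/-- **The projection maps `H¹⁰_df` to `H¹⁰_df`** (so `u_{i,n}(t) ∈ H¹⁰_df` for a mild solution,
and `P_{i,n} w` is an admissible test field for every `w ∈ H¹⁰_df`). [folklore] -/
theorem MemH10df.modeProjection {u : L2C} (hu : MemH10df u) : MemH10df (modeProjection 𝒟 i n u) :=
  ⟨(eFourierSobolevNorm_modeProjection_le 𝒟 i n 10 u).trans_lt hu.1, hu.2.1.modeProjection 𝒟 i n,
    hu.2.2.modeProjection 𝒟 i n⟩

/-! ### Parseval for the bilinear pairing; self-adjointness of the projection -/

/-- The bilinear pairing is an `L²` inner product against the conjugate field: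
`⟨u, w⟩ = ⟪w̄, u⟫`. [folklore] -/
theorem pairing_eq_inner_conjL2 (u w : L2C) : pairing u w = inner ℂ (conjL2 w) u := by
  rw [pairing, MeasureTheory.L2.inner_def]
  refine integral_congr_ae ?_
  filter_upwards [coeFn_conjL2 w] with x hx
  change cdot _ _ = inner ℂ ((conjL2 w : EuclideanSpace ℝ (Fin 3) → EuclideanSpace ℂ (Fin 3)) x) _
  rw [hx]
  simp only [cdot, PiLp.inner_apply, RCLike.inner_apply, conj3_apply, Complex.conj_conj]

/-- **Parseval for the bilinear pairing** (no realness assumed):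
`⟨u, w⟩ = ∫ û(ξ) · ŵ(-ξ) dξ` (from `𝓕(w̄)(ξ) = \overline{ŵ(-ξ)}` and Plancherel). [folklore] -/
theorem pairing_eq_integral_cdot_fourierFn (u w : L2C) :
    pairing u w = ∫ ξ, cdot (fourierFn u ξ) (fourierFn w (-ξ)) := by
  rw [pairing_eq_inner_conjL2, ← MeasureTheory.Lp.inner_fourier_eq, MeasureTheory.L2.inner_def]
  refine integral_congr_ae ?_
  filter_upwards [fourierFn_conjL2 w] with ξ hξ
  change inner ℂ (fourierFn (conjL2 w) ξ) (fourierFn u ξ) = _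
  rw [hξ]
  simp only [cdot, PiLp.inner_apply, RCLike.inner_apply, conj3_apply, Complex.conj_conj]

/-- **The projection is self-adjoint for the bilinear pairing**, `⟨P u, w⟩ = ⟨u, P w⟩` (its
symbol is even; Tao uses this implicitly in "taking inner products of (4.14) with `ψ_{i,n}`",
p. 22). [folklore] -/
theorem pairing_modeProjection_left (u w : L2C) :
    pairing (modeProjection 𝒟 i n u) w = pairing u (modeProjection 𝒟 i n w) := by
  rw [pairing_eq_integral_cdot_fourierFn, pairing_eq_integral_cdot_fourierFn]
  refine integral_congr_ae ?_
  have hq : Measure.QuasiMeasurePreserving (fun x : EuclideanSpace ℝ (Fin 3) => -x) volume volume :=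
    (Measure.measurePreserving_neg (volume : Measure (EuclideanSpace ℝ (Fin 3)))).quasiMeasurePreserving
  have hleft : ∀ (c : ℂ) (a b : EuclideanSpace ℂ (Fin 3)), cdot (c • a) b = c * cdot a b :=
    fun c a b => by simp [cdot, Finset.mul_sum, mul_assoc]
  filter_upwards [fourierFn_modeProjection 𝒟 i n u,
    hq.ae_eq (fourierFn_modeProjection 𝒟 i n w)] with ξ h1 h2
  rw [h1, show fourierFn (modeProjection 𝒟 i n w) (-ξ) =
      (freqRegion 𝒟 i n).indicator (fun _ => (1 : ℂ)) (-ξ) • fourierFn w (-ξ) from h2,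
    indicator_freqRegion_neg, cdot_smul_right, hleft]

/-- In particular `⟨P u, P w⟩ = ⟨u, P w⟩`. [folklore] -/
theorem pairing_modeProjection_modeProjection (u w : L2C) :
    pairing (modeProjection 𝒟 i n u) (modeProjection 𝒟 i n w) = pairing u (modeProjection 𝒟 i n w) := by
  rw [pairing_modeProjection_left, modeProjection_modeProjection]

/-- **Plancherel for the `L²` norm**: `‖v‖² = ∫ |v̂(ξ)|² dξ`. [folklore] -/
theorem norm_sq_eq_integral_fourierFn (v : L2C) : ‖v‖ ^ 2 = ∫ ξ, ‖fourierFn v ξ‖ ^ 2 := by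
  rw [← MeasureTheory.Lp.norm_fourier_eq v, @norm_sq_eq_re_inner ℂ, MeasureTheory.L2.inner_def,
    ← integral_re (MeasureTheory.L2.integrable_inner _ _)]
  exact integral_congr_ae (Eventually.of_forall fun ξ => inner_self_eq_norm_sq (𝕜 := ℂ) _)

/-- **The local energy on the Fourier side**: `‖u_{i,n}‖² = ∫_{A_{i,n}} |û(ξ)|² dξ`
(Plancherel; Tao, p. 22: "from Plancherel … we have (4.7)"). [cite: Tao2016AveragedNS, Lemma 4.1 (4.5)] -/
theorem norm_sq_modeProjection (u : L2C) :
    ‖modeProjection 𝒟 i n u‖ ^ 2 = ∫ ξ in freqRegion 𝒟 i n, ‖fourierFn u ξ‖ ^ 2 := by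
  rw [norm_sq_eq_integral_fourierFn, ← integral_indicator (measurableSet_freqRegion 𝒟 i n)]
  refine integral_congr_ae ?_
  filter_upwards [fourierFn_modeProjection 𝒟 i n u] with ξ hξ
  rw [hξ]
  by_cases h : ξ ∈ freqRegion 𝒟 i n
  · simp [h]
  · simp [h]

end Projection

/-! ### The heat flow: self-adjointness, realness, `H¹⁰_df` -/

/-- The heat symbol is even. [folklore] -/
theorem heatSymbol_neg (τ : ℝ) (ξ : EuclideanSpace ℝ (Fin 3)) : heatSymbol τ (-ξ) = heatSymbol τ ξ := by
  simp [heatSymbol, norm_neg]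

/-- The heat symbol is real. [folklore] -/
theorem conj_heatSymbol (τ : ℝ) (ξ : EuclideanSpace ℝ (Fin 3)) :
    conj (heatSymbol τ ξ) = heatSymbol τ ξ := by
  unfold heatSymbol
  exact Complex.conj_ofReal _

/-- **The heat flow is self-adjoint for the bilinear pairing**: `⟨e^{τΔ}u, w⟩ = ⟨u, e^{τΔ}w⟩`
(its symbol is even; this is the transposition by which `e^{(t-t')Δ}` acts on `(H¹⁰_df)*` in
the mild formulation (1.15)/(3.3)). [cite: Tao2016AveragedNS, (1.15)] -/
theorem pairing_heat_left (τ : ℝ) (u w : L2C) : pairing (heat τ u) w = pairing u (heat τ w) := by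
  rw [pairing_eq_integral_cdot_fourierFn, pairing_eq_integral_cdot_fourierFn]
  refine integral_congr_ae ?_
  have hq : Measure.QuasiMeasurePreserving (fun x : EuclideanSpace ℝ (Fin 3) => -x) volume volume :=
    (Measure.measurePreserving_neg (volume : Measure (EuclideanSpace ℝ (Fin 3)))).quasiMeasurePreserving
  have hleft : ∀ (c : ℂ) (a b : EuclideanSpace ℂ (Fin 3)), cdot (c • a) b = c * cdot a b :=
    fun c a b => by simp [cdot, Finset.mul_sum, mul_assoc]
  filter_upwards [fourierFn_heat τ u, hq.ae_eq (fourierFn_heat τ w)] with ξ h1 h2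
  rw [h1, show fourierFn (heat τ w) (-ξ) = heatSymbol τ (-ξ) • fourierFn w (-ξ) from h2,
    heatSymbol_neg, cdot_smul_right, hleft]

/-- **The heat flow commutes with conjugation** (its symbol is real and even), so it preserves
realness. [folklore] -/
theorem conjL2_heat (τ : ℝ) (u : L2C) : conjL2 (heat τ u) = heat τ (conjL2 u) := by
  apply eq_of_fourierFn_ae_eq
  have hq : Measure.QuasiMeasurePreserving (fun x : EuclideanSpace ℝ (Fin 3) => -x) volume volume :=
    (Measure.measurePreserving_neg (volume : Measure (EuclideanSpace ℝ (Fin 3)))).quasiMeasurePreserving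
  filter_upwards [fourierFn_conjL2 (heat τ u), hq.ae_eq (fourierFn_heat τ u),
    fourierFn_heat τ (conjL2 u), fourierFn_conjL2 u] with ξ h1 h2 h3 h4
  rw [h1, h3, h4, show fourierFn (heat τ u) (-ξ) = heatSymbol τ (-ξ) • fourierFn u (-ξ) from h2,
    conj3_smul, heatSymbol_neg, conj_heatSymbol]

/-- **The heat flow preserves realness** (the realness clause of "`e^{τΔ}` maps `H¹⁰_df` to
itself" left unproved in `TaoAveragedSobolev.lean`). [folklore] -/
theorem IsReal.heat {u : L2C} (hu : IsReal u) (τ : ℝ) : IsReal (heat τ u) := by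
  rw [isReal_iff_conjL2_eq] at hu ⊢
  rw [conjL2_heat, hu]

/-- **The heat flow maps `H¹⁰_df` to `H¹⁰_df`.** [folklore] -/
theorem MemH10df.heat {u : L2C} (hu : MemH10df u) (τ : ℝ) : MemH10df (heat τ u) :=
  ⟨(eFourierSobolevNorm_heat_le 10 τ u).trans_lt hu.1, hu.2.1.heat τ, hu.2.2.heat τ⟩

/-! ### The cascade operator tested against a frequency-localised field -/

section Localised

variable (ε₀ : ℝ) (ψ : Fin m → 𝓢(EuclideanSpace ℝ (Fin 3), EuclideanSpace ℝ (Fin 3)))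
  (α : Fin m → Fin m → Fin m → ℤ × ℤ × ℤ → ℝ)

/-- The (complex) **quadratic nonlinearity driving the mode `(i,n)`**:
`∑_{i₁,i₂} ∑_{μ ∈ S} α_{i₁,i₂,i,μ} (1+ε₀)^{5(n-μ₃)/2} ⟨f, ψ_{i₁,n-μ₃+μ₁}⟩ ⟨f, ψ_{i₂,n-μ₃+μ₂}⟩`, the
main term of (4.10)/(4.15) with the complex pairings of `f` (for a real field `f` it is the
accepted real `TaoCascade.quadTerm` of the coefficients `Re ⟨f, ψ_{j,k}⟩`, `quadTermC_eq_ofReal`). [cite: Tao2016AveragedNS, §4 (4.10)] -/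
def quadTermC (f : L2C) (i : Fin m) (n : ℤ) : ℂ :=
  ∑ i₁, ∑ i₂, ∑ μ ∈ TaoCascade.shiftSet,
    (α i₁ i₂ i μ : ℂ) * (((1 + ε₀) ^ ((5 : ℝ) * (n - μ.2.2) / 2) : ℝ) : ℂ) *
      (pairing f (cascadeWavelet ε₀ (ψ i₁) (n - μ.2.2 + μ.1)) *
        pairing f (cascadeWavelet ε₀ (ψ i₂) (n - μ.2.2 + μ.2.1)))

variable {ε₀ ψ α}

/-- **The cascade operator against a field paired only with `ψ_{i,n}`**: if `⟨g, ψ_{j,k}⟩ = 0`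
for all `(j,k) ≠ (i,n)`, then in `⟨C(f,f), g⟩` (4.1) only the terms with output wavelet `ψ_{i,n}`
survive, i.e. `i₃ = i` and `n' = n - μ₃`:
`⟨C(f,f), g⟩ = quadTermC(f)_{i,n} · ⟨g, ψ_{i,n}⟩` (Tao, p. 22: "Taking inner products of (4.14)
with `ψ_{i,n}`"). Every scale series has at most one nonzero term, so no convergence is needed. [cite: Tao2016AveragedNS, §4 (4.15)] -/
theorem cascadeOperatorForm_eq_quadTermC_mul (f g : L2C) (i : Fin m) (n : ℤ)
    (hg : ∀ (j : Fin m) (k : ℤ), (j, k) ≠ (i, n) → pairing g (cascadeWavelet ε₀ (ψ j) k) = 0) :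
    cascadeOperatorForm ε₀ ψ α f f g = quadTermC ε₀ ψ α f i n * pairing g (cascadeWavelet ε₀ (ψ i) n) := by
  classical
  -- each scale series collapses to the single scale `n' = n - μ₃`
  have htsum : ∀ (i₁ i₂ i₃ : Fin m) (μ : ℤ × ℤ × ℤ),
      (∑' n' : ℤ, (((1 + ε₀) ^ ((5 : ℝ) * (n' : ℝ) / 2) : ℝ) : ℂ) *
        (pairing f (cascadeWavelet ε₀ (ψ i₁) (n' + μ.1)) *
          pairing f (cascadeWavelet ε₀ (ψ i₂) (n' + μ.2.1)) *
          pairing g (cascadeWavelet ε₀ (ψ i₃) (n' + μ.2.2)))) =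
      (((1 + ε₀) ^ ((5 : ℝ) * (n - μ.2.2) / 2) : ℝ) : ℂ) *
        (pairing f (cascadeWavelet ε₀ (ψ i₁) (n - μ.2.2 + μ.1)) *
          pairing f (cascadeWavelet ε₀ (ψ i₂) (n - μ.2.2 + μ.2.1)) *
          (if i₃ = i then pairing g (cascadeWavelet ε₀ (ψ i) n) else 0)) := by
    intro i₁ i₂ i₃ μ
    rw [tsum_eq_single (n - μ.2.2)]
    · rw [sub_add_cancel]
      push_cast
      split_ifs with h
      · subst h
        rfl
      · rw [hg i₃ n (fun h' => h (Prod.mk.inj h').1)]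
    · intro n' hn'
      rw [hg i₃ (n' + μ.2.2) (fun h' => hn' (by have := (Prod.mk.inj h').2; omega))]
      simp
  unfold cascadeOperatorForm quadTermC
  simp_rw [htsum]
  rw [Finset.sum_mul]
  refine Finset.sum_congr rfl fun i₁ _ => ?_
  rw [Finset.sum_mul]
  refine Finset.sum_congr rfl fun i₂ _ => ?_
  rw [Finset.sum_comm, Finset.sum_mul]
  refine Finset.sum_congr rfl fun μ _ => ?_
  simp only [mul_ite, mul_zero, Finset.sum_ite_eq', Finset.mem_univ, if_true]
  ring

/-- For a **real** field `f` the complex quadratic term is the real `quadTerm` of the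
coefficients `X_{j,k} = Re ⟨f, ψ_{j,k}⟩` (the pairing of real fields is real). [cite: Tao2016AveragedNS, §4 (4.10)] -/
theorem quadTermC_eq_ofReal {f : L2C} (hf : IsReal f) (i : Fin m) (n : ℤ) :
    quadTermC ε₀ ψ α f i n =
      ((TaoCascade.quadTerm ε₀ α (fun j k (_ : ℝ) => (pairing f (cascadeWavelet ε₀ (ψ j) k)).re)
        i n 0 : ℝ) : ℂ) := by
  have hre : ∀ (j : Fin m) (k : ℤ), pairing f (cascadeWavelet ε₀ (ψ j) k) =
      (((pairing f (cascadeWavelet ε₀ (ψ j) k)).re : ℝ) : ℂ) := fun j k =>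
    eq_ofReal_re_of_im_eq_zero (pairing_im hf (isReal_cascadeWavelet ε₀ (ψ j) k))
  unfold quadTermC TaoCascade.quadTerm
  push_cast
  refine Finset.sum_congr rfl fun i₁ _ => Finset.sum_congr rfl fun i₂ _ =>
    Finset.sum_congr rfl fun μ _ => ?_
  conv_lhs => rw [hre i₁, hre i₂]

end Localised

/-! ### `H¹⁰_df` is a real subspace -/

/-- Realness is additive. [folklore] -/
theorem IsReal.add {u v : L2C} (hu : IsReal u) (hv : IsReal v) : IsReal (u + v) := by
  rw [isReal_iff_conjL2_eq] at hu hv ⊢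
  rw [conjL2_add, hu, hv]

/-- Realness is preserved by real scalars. [folklore] -/
theorem IsReal.smul {u : L2C} (hu : IsReal u) (c : ℝ) : IsReal ((c : ℂ) • u) := by
  unfold IsReal at *
  filter_upwards [hu, Lp.coeFn_smul (c : ℂ) u] with x h1 h2
  intro k
  rw [h2, Pi.smul_apply, PiLp.smul_apply, smul_eq_mul, Complex.mul_im, h1 k, Complex.ofReal_im]
  ring

/-- `H¹⁰_df` is closed under addition. [folklore] -/
theorem MemH10df.add {u v : L2C} (hu : MemH10df u) (hv : MemH10df v) : MemH10df (u + v) := by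
  have h := hu.memH10dfC.add hv.memH10dfC
  exact ⟨h.1, hu.2.1.add hv.2.1, h.2⟩

/-- `H¹⁰_df` is closed under real scalar multiplication. [folklore] -/
theorem MemH10df.smul {u : L2C} (hu : MemH10df u) (c : ℝ) : MemH10df ((c : ℂ) • u) := by
  have h := hu.memH10dfC.smul (c : ℂ)
  exact ⟨h.1, hu.2.1.smul c, h.2⟩

/-- `H¹⁰_df` is closed under subtraction. [folklore] -/
theorem MemH10df.sub {u v : L2C} (hu : MemH10df u) (hv : MemH10df v) : MemH10df (u - v) := by
  rw [sub_eq_add_neg, ← neg_one_smul ℂ v, show (-1 : ℂ) = ((-1 : ℝ) : ℂ) by norm_num]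
  exact hu.add (hv.smul (-1))

/-- **A real field orthogonal to itself vanishes**: `⟨w, w⟩ = 0 ⇒ w = 0` (`⟨w, w⟩ = ‖w‖²` on real
fields). This is how an identity in `(H¹⁰_df)*` tested on `w ∈ H¹⁰_df` becomes an identity in `L²`. [folklore] -/
theorem eq_zero_of_pairing_self_eq_zero {w : L2C} (hw : IsReal w) (h : pairing w w = 0) : w = 0 := by
  have h2 : pairing w w = inner ℂ (conjL2 w) w := pairing_eq_inner_conjL2 w w
  rw [(isReal_iff_conjL2_eq w).1 hw] at h2
  rw [h2, inner_self_eq_zero] at h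
  exact h

end Literature.Analysis.FluidPDE.Tao2016
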